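import Summits.MatrixMultiplication.MatrixMultiplication.Theorems.AbelianSTPPCensusShapeCertVQDefsS
import Summits.MatrixMultiplication.MatrixMultiplication.Theorems.AbelianSTPPCensusShapeCertVQTables

/-!
# Abelian STPP census — soundness of `ShapeCertVQ.checkQS`, part 0: the level cap is sound (one-time kernel checks over the universe)

Cell mm-stpp, rung F-M1; successor kernel item VQ-CERT (T_E beyond 337 under vQ := vP ∧ E3⁺) in support of the closed crux item
stmt-MatrixMultiplication-19191; seat mm-stpp-vp-p2 (gen 2).
* `capOKQ_s0 … capOKQ_s7` — every universe shape of order `489` passes the cap test `ShapeCertVQ.capP` with its own packing mass,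
  volume and ratio level (`243·L⁴ ≤ 64⁴·(ab+bc+ca)` and `729·L⁶ ≤ 64⁶·V`; kernel evaluation over the eight universe slices of
  `…ShapeCertVQTables`), hence `capP_of_inUniv` for every universe shape of every order `M ≤ 489`;
* `capP_mono` — the test is monotone in the mass and volume bounds;
* `lt_lcapS` — a level below `hiLev` passing the test lies below the node's level cap `lcapS q vl` (the downward scan `lcapGo` stops at
  the first passing level), so a tail member with packing mass `≤ q` and volume `≤ vl` has ratio level `< lcapS q vl`
  (`levTQ_lt_lcapS`) — the fact that lets `loopS` pass over whole candidate blocks.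
-/

set_option linter.dupNamespace false -- `MatrixMultiplication.MatrixMultiplication` (summit = problem, D-0017)
set_option autoImplicit false

namespace Summit.MatrixMultiplication.MatrixMultiplication.Theorems.ShapeCertVQ

open ShapeCert ShapeCertVP

/-! ### The cap test over the universe of order `489` (slices as in `…ShapeCertVQTables`) -/

/-- cap test, universe slice `a = 1` -/
theorem capOKQ_s0 : ((univ0Q 489 0 1).all capOKQ) = true := by decide +kernel
/-- cap test, universe slice `a = 2` -/
theorem capOKQ_s1 : ((univ0Q 489 1 1).all capOKQ) = true := by decide +kernel
/-- cap test, universe slice `a = 3` -/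
theorem capOKQ_s2 : ((univ0Q 489 2 1).all capOKQ) = true := by decide +kernel
/-- cap test, universe slice `a ∈ [4, 5]` -/
theorem capOKQ_s3 : ((univ0Q 489 3 2).all capOKQ) = true := by decide +kernel
/-- cap test, universe slice `a ∈ [6, 8]` -/
theorem capOKQ_s4 : ((univ0Q 489 5 3).all capOKQ) = true := by decide +kernel
/-- cap test, universe slice `a ∈ [9, 14]` -/
theorem capOKQ_s5 : ((univ0Q 489 8 6).all capOKQ) = true := by decide +kernel
/-- cap test, universe slice `a ∈ [15, 24]` -/
theorem capOKQ_s6 : ((univ0Q 489 14 10).all capOKQ) = true := by decide +kernel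
/-- cap test, universe slice `a ∈ [25, 489]` -/
theorem capOKQ_s7 : ((univ0Q 489 24 465).all capOKQ) = true := by decide +kernel

/-- **the cap test holds for every universe shape of order `489`** (the eight slices cover `1 ≤ a ≤ 489`; after `allOKQ_of_inUniv`) -/
theorem capOKQ_of_inUniv {x : ℕ × ℕ × ℕ} (hx : InUniv 489 x) : capOKQ (shQ 489 x) = true := by
  have ha := hx.a_le
  obtain ⟨ha1, -, -⟩ := hx.pos
  have pick : ∀ {lo n : ℕ}, ((univ0Q 489 lo n).all capOKQ) = true → lo ≤ x.1 - 1 → x.1 - 1 < lo + n →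
      capOKQ (shQ 489 x) = true :=
    fun h h1 h2 => List.all_eq_true.mp h _ (shQ_mem_univ0Q hx h1 h2)
  rcases Nat.lt_or_ge (x.1 - 1) 1 with h | h
  · exact pick capOKQ_s0 (Nat.zero_le _) (by omega)
  rcases Nat.lt_or_ge (x.1 - 1) 2 with h' | h'
  · exact pick capOKQ_s1 h (by omega)
  rcases Nat.lt_or_ge (x.1 - 1) 3 with h'' | h''
  · exact pick capOKQ_s2 h' (by omega)
  rcases Nat.lt_or_ge (x.1 - 1) 5 with h3 | h3
  · exact pick capOKQ_s3 h'' (by omega)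
  rcases Nat.lt_or_ge (x.1 - 1) 8 with h4 | h4
  · exact pick capOKQ_s4 h3 (by omega)
  rcases Nat.lt_or_ge (x.1 - 1) 14 with h5 | h5
  · exact pick capOKQ_s5 h4 (by omega)
  rcases Nat.lt_or_ge (x.1 - 1) 24 with h6 | h6
  · exact pick capOKQ_s6 h5 (by omega)
  · exact pick capOKQ_s7 h6 (by omega)

/-! ### Consequences -/

/-- the cap test is monotone in the mass and volume bounds -/
theorem capP_mono {q q' vl vl' L : ℕ} (h : capP q vl L = true) (hq : q ≤ q') (hv : vl ≤ vl') : capP q' vl' L = true := by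
  unfold capP at h ⊢
  simp only [Bool.and_eq_true, decide_eq_true_eq] at h ⊢
  exact ⟨h.1.trans (Nat.mul_le_mul_left _ hq), h.2.trans (Nat.mul_le_mul_left _ hv)⟩

/-- **a universe shape of order `M ≤ 489` passes the cap test at its own level** with any mass bound `≥ ab+bc+ca` and volume bound `≥ V` -/
theorem capP_of_inUniv {M : ℕ} {x : ℕ × ℕ × ℕ} (hM : M ≤ 489) (hx : InUniv M x) {q vl : ℕ} (hq : uu x ≤ q) (hv : vol x ≤ vl) :
    capP q vl (levTQ x) = true := by
  have h := capOKQ_of_inUniv (inUniv_mono hx hM)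
  unfold capOKQ at h
  rw [shQ_ab, shQ_bc, shQ_ca, shQ_V, shQ_lev] at h
  exact capP_mono h (by unfold uu at hq; exact hq) hv

/-- invariant of the downward scan: if every level in `[c, hiLev)` fails the test, so does every level in `[lcapGo … n c, hiLev)` -/
theorem lcapGo_spec (q vl : ℕ) : ∀ (n c : ℕ), (∀ L, c ≤ L → L < hiLev → capP q vl L = false) →
    ∀ L, lcapGo q vl n c ≤ L → L < hiLev → capP q vl L = false
  | 0, _, h => by rw [lcapGo]; exact h
  | n + 1, c, h => by
    rw [lcapGo]
    by_cases hc : capP q vl (c - 1) = true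
    · rw [if_pos hc]; exact h
    · rw [if_neg hc]
      refine lcapGo_spec q vl n (c - 1) ?_
      intro L hL hL'
      by_cases hLc : L = c - 1
      · rw [hLc]; simpa using hc
      · exact h L (by omega) hL'

/-- **a level below `hiLev` passing the cap test lies below the level cap** -/
theorem lt_lcapS {q vl L : ℕ} (hL : L < hiLev) (hc : capP q vl L = true) : L < lcapS q vl := by
  by_contra hge
  have h := lcapGo_spec q vl (hiLev - loLev - 1) hiLev (fun L h1 h2 => absurd h2 (not_lt.mpr h1)) L (not_lt.mp hge) hL
  rw [hc] at h
  exact Bool.noConfusion h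

/-- **a universe shape with packing mass `≤ q` and volume `≤ vl` has ratio level below the cap `lcapS q vl`** -/
theorem levTQ_lt_lcapS {M : ℕ} {x : ℕ × ℕ × ℕ} (hM : M ≤ 489) (hx : InUniv M x) {q vl : ℕ} (hq : uu x ≤ q) (hv : vol x ≤ vl) :
    levTQ x < lcapS q vl :=
  lt_lcapS (loLev_lt_levTQ hM hx).2 (capP_of_inUniv hM hx hq hv)

end Summit.MatrixMultiplication.MatrixMultiplication.Theorems.ShapeCertVQ
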